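import Literature.GroupTheory.CombinatorialGroupTheory.RandomSclFreeGroupProofs
import HarnessLib

/-!
# Random rigidity of scl (Calegari–Walker 2013): proofs, part 15 — products of conjugates of powers

D. Calegari, A. Walker, *Random rigidity in the free group*, Geom. Topol. 17 (2013)
[CalegariWalker2013], §4.3: the fatgraph built from tripods bounds *a multiple of `v`*, i.e. its
boundary is a union of components reading powers of cyclic conjugates of `v`. At the level of
commutator length this is the elementary algebra

  `∏ᵢ gᵢ v^{kᵢ} gᵢ⁻¹ = c · v^{∑ kᵢ}` with `cl(c) ≤ m` (the number of factors),

since `g v^k g⁻¹ = [g, v^k] v^k` and conjugates of commutators are commutators. Hence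
`cl(v^{∑ kᵢ}) ≤ cl(∏ᵢ gᵢ v^{kᵢ} gᵢ⁻¹) + m` and `scl(v) ≤ (cl(∏ᵢ gᵢ v^{kᵢ} gᵢ⁻¹) + m) / ∑ kᵢ`:
a surface with `m` boundary components covering `v` in total `K` times certifies
`scl(v) ≤ (genus + m)/K` [cf. Calegari, *scl*, Prop. 2.10].

* **`conjProd_eq_commutators_mul_pow`**, **`commutatorLength_pow_sum_le_conjProd`**,
  **`stableCommutatorLength_le_of_conjProd`**.
-/

namespace Literature.GroupTheory.CombinatorialGroupTheory

section ConjugateProducts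

variable {G : Type*} [Group G]

/-- `∏ᵢ gᵢ v^{kᵢ} gᵢ⁻¹ = c · v^{∑ kᵢ}` with `c` a product of at most `m` commutators. [folklore] -/
theorem conjProd_eq_commutators_mul_pow (v : G) (l : List (G × ℕ)) :
    ∃ c : G, c ∈ commutator G ∧ commutatorLength c ≤ l.length ∧
      (l.map fun p => p.1 * v ^ p.2 * p.1⁻¹).prod = c * v ^ (l.map Prod.snd).sum := by
  induction l with
  | nil => exact ⟨1, one_mem _, by simp, by simp⟩
  | cons p l ih =>
    obtain ⟨c', hc'mem, hc'len, hprod⟩ := ih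
    obtain ⟨g, k⟩ := p
    have hmem1 : g * v ^ k * g⁻¹ * (v ^ k)⁻¹ ∈ commutator G :=
      Subgroup.commutator_mem_commutator (Subgroup.mem_top g) (Subgroup.mem_top (v ^ k))
    have hconj : v ^ k * c' * (v ^ k)⁻¹ ∈ commutator G :=
      Subgroup.Normal.conj_mem inferInstance c' hc'mem (v ^ k)
    refine ⟨(g * v ^ k * g⁻¹ * (v ^ k)⁻¹) * (v ^ k * c' * (v ^ k)⁻¹), mul_mem hmem1 hconj, ?_, ?_⟩
    · have h1 : commutatorLength (g * v ^ k * g⁻¹ * (v ^ k)⁻¹) ≤ 1 :=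
        commutatorLength_commutatorElement_le g (v ^ k)
      have h2 : commutatorLength (v ^ k * c' * (v ^ k)⁻¹) = commutatorLength c' :=
        commutatorLength_conj c' (v ^ k)
      have h3 : commutatorLength (g * v ^ k * g⁻¹ * (v ^ k)⁻¹ * (v ^ k * c' * (v ^ k)⁻¹)) ≤
          commutatorLength (g * v ^ k * g⁻¹ * (v ^ k)⁻¹) +
            commutatorLength (v ^ k * c' * (v ^ k)⁻¹) := commutatorLength_mul_le hmem1 hconj
      simp only [List.length_cons]
      omega
    · simp only [List.map_cons, List.prod_cons, List.sum_cons, hprod, pow_add]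
      group

/-- **`cl(v^{∑ kᵢ}) ≤ cl(∏ᵢ gᵢ v^{kᵢ} gᵢ⁻¹) + m`** for `v ∈ [G,G]`. [folklore] -/
theorem commutatorLength_pow_sum_le_conjProd {v : G} (hv : v ∈ commutator G) (l : List (G × ℕ)) :
    commutatorLength (v ^ (l.map Prod.snd).sum) ≤
      commutatorLength (l.map fun p => p.1 * v ^ p.2 * p.1⁻¹).prod + l.length := by
  obtain ⟨c, hcmem, hclen, hprod⟩ := conjProd_eq_commutators_mul_pow v l
  have hvK : v ^ (l.map Prod.snd).sum ∈ commutator G := Subgroup.pow_mem _ hv _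
  have hPmem : (l.map fun p => p.1 * v ^ p.2 * p.1⁻¹).prod ∈ commutator G := by
    rw [hprod]; exact mul_mem hcmem hvK
  have e : v ^ (l.map Prod.snd).sum = c⁻¹ * (l.map fun p => p.1 * v ^ p.2 * p.1⁻¹).prod := by
    rw [hprod, ← mul_assoc, inv_mul_cancel, one_mul]
  rw [e]
  have h := commutatorLength_mul_le (inv_mem hcmem) hPmem
  rw [commutatorLength_inv] at h
  omega

/-- **`scl(v) ≤ (cl(∏ᵢ gᵢ v^{kᵢ} gᵢ⁻¹) + m) / ∑ kᵢ`**: a surface whose boundary components cover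
`v` in total `K = ∑ kᵢ > 0` times certifies `scl` (cf. Calegari, *scl*, Prop. 2.10). [folklore] -/
theorem stableCommutatorLength_le_of_conjProd {v : G} (hv : v ∈ commutator G) (l : List (G × ℕ))
    (hK : (l.map Prod.snd).sum ≠ 0) :
    stableCommutatorLength v ≤
      ((commutatorLength (l.map fun p => p.1 * v ^ p.2 * p.1⁻¹).prod : ℝ) + l.length) /
        ((l.map Prod.snd).sum : ℕ) := by
  refine (stableCommutatorLength_le_div v hK).trans ?_
  apply div_le_div_of_nonneg_right _ (Nat.cast_nonneg _)
  exact_mod_cast commutatorLength_pow_sum_le_conjProd hv l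

end ConjugateProducts

end Literature.GroupTheory.CombinatorialGroupTheory
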